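import Literature.MathematicalPhysics.QuantumManyBody.BoseGasHardCoreContact
import Mathlib.Analysis.InnerProductSpace.Projection.Reflection
import Mathlib.MeasureTheory.Measure.Haar.InnerProductSpace

/-!
# The hard set of a pair potential: where finite-energy wave functions must vanish

Topic `Literature/MathematicalPhysics/QuantumManyBody`, over the carriers of
`BoseEinsteinCondensation.lean` (`Space = ℝ³`, `Config N = (ℝ³)^N`, `interaction`,
`IsRepulsiveFiniteRange`) and `BoseGasThermodynamicLimitRuelle.lean` (`rawEnergy`).

For an ARBITRARY measurable pair potential `v : ℝ → [0, ∞]` (hard cores, `+∞` on any set of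
distances, non-integrable singularities all allowed — the standing class `IsRepulsiveFiniteRange`
of LSSY 2005, Ch. 2) the rôle played by the open core `{|xᵢ - xⱼ| < a}` of the hard-sphere gas is
taken by the **hard set**

* `hardVec v = 𝓗(v) := {z ∈ ℝ³ | ∀ η > 0, ∫_{B(z,η)} v(|w|) dw = +∞}`,

the set of relative positions near which `w ↦ v(|w|)` is not integrable. Main results:

* `eq_zero_of_sub_mem_hardVec` — **finite energy keeps the particles off the hard set**: a
  continuous wave function of finite energy vanishes at every configuration with
  `xᵢ - xⱼ ∈ 𝓗(v)` (if `ψ(X) ≠ 0` then `|ψ|² ≥ c > 0` on a ball around `X`, and integrating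
  `v(|xᵢ - xⱼ|)` in `xᵢ` over that ball alone already gives `+∞`; Fubini in the single coordinate
  `xᵢ` through Mathlib's marginal integrals);
* `isClosed_hardVec`, `mem_hardVec_iff_of_norm_eq` (rotation invariance, by a reflection taking
  `z` to `z'` and the invariance of Lebesgue measure under linear isometries),
  `not_mem_hardVec_of_lt_norm` (`𝓗(v) ⊆ B̄(0, R₀)` for a potential of range `R₀`);
* `hardRad v` — the radial description `{r ≥ 0 | r e₀ ∈ 𝓗(v)}`, closed, with
  `mem_hardVec_iff_norm_mem_hardRad`; `eq_zero_of_norm_sub_mem_hardRad` — `ψ` vanishes on the whole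
  sphere `|xᵢ - xⱼ| = h` for every hard radius `h`;
* `setLIntegral_lt_top_of_isCompact_subset_compl_hardVec` — on every compact set of relative
  positions avoiding `𝓗(v)` the potential is integrable (finite subcover by integrability balls).

These are the two inputs ("where must `ψ` vanish" / "where is `v` harmless") of the free-volume
argument for general potentials (sequel files). Everything here is standard real analysis and is
tagged folklore; the physical context is LSSY 2005, Ch. 2, (2.1)–(2.2).

References: E. H. Lieb, R. Seiringer, J. P. Solovej, J. Yngvason, *The Mathematics of the Bose Gas
and its Condensation* (2005) [LSSY2005], Ch. 2.
-/

noncomputable section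

open MeasureTheory Filter Topology Set Function Metric
open scoped ENNReal NNReal

namespace Literature.MathematicalPhysics.QuantumManyBody.BoseGas

/-! ### Local integrals of the potential and the hard set -/

section HardSet

variable {v : ℝ → ℝ≥0∞}

/-- The integral of `w ↦ v(|w|)` over the ball `B(z, η)` of relative positions. [folklore] -/
def ballIntegral (v : ℝ → ℝ≥0∞) (z : Space) (η : ℝ) : ℝ≥0∞ :=
  ∫⁻ w in ball z η, v ‖w‖

/-- The **hard set** `𝓗(v)` of the potential: relative positions near which `v(|·|)` is not
integrable. [folklore] -/
def hardVec (v : ℝ → ℝ≥0∞) : Set Space :=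
  {z | ∀ η : ℝ, 0 < η → ballIntegral v z η = ⊤}

/-- Monotonicity of the ball integral in the ball. [folklore] -/
theorem ballIntegral_mono {z z' : Space} {η η' : ℝ} (h : ball z η ⊆ ball z' η') :
    ballIntegral v z η ≤ ballIntegral v z' η' :=
  lintegral_mono_set h

/-- Outside the hard set some ball has finite integral. [folklore] -/
theorem not_mem_hardVec_iff {z : Space} :
    z ∉ hardVec v ↔ ∃ η : ℝ, 0 < η ∧ ballIntegral v z η < ⊤ := by
  simp only [hardVec, mem_setOf_eq, not_forall, exists_prop, lt_top_iff_ne_top]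

/-- The complement of the hard set is open: a finite ball around `z` contains balls around all
nearby points. [folklore] -/
theorem isOpen_compl_hardVec : IsOpen (hardVec v)ᶜ := by
  rw [isOpen_iff_forall_mem_open]
  intro z hz
  obtain ⟨η, hη, hfin⟩ := not_mem_hardVec_iff.1 hz
  refine ⟨ball z (η / 2), fun z' hz' => ?_, isOpen_ball, mem_ball_self (by positivity)⟩
  refine not_mem_hardVec_iff.2 ⟨η / 2, by positivity, lt_of_le_of_lt (ballIntegral_mono ?_) hfin⟩
  exact ball_subset_ball' (by rw [mem_ball] at hz'; linarith [hz'.le])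

/-- The hard set is closed. [folklore] -/
theorem isClosed_hardVec : IsClosed (hardVec v) :=
  compl_compl (hardVec v) ▸ isOpen_compl_hardVec.isClosed_compl

/-- **Rotation invariance of the ball integrals**: `∫_{B(z,η)} v(|w|) dw` depends only on `|z|`
(reflect `z` to `z'`; linear isometries preserve Lebesgue measure and `|·|`). [folklore] -/
theorem ballIntegral_eq_of_norm_eq {z z' : Space} (h : ‖z‖ = ‖z'‖) (η : ℝ) :
    ballIntegral v z η = ballIntegral v z' η := by
  -- the reflection taking `z` to `z'`
  set R : Space ≃ₗᵢ[ℝ] Space := Submodule.reflection (ℝ ∙ (z - z'))ᗮ with hR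
  have hRz : R z = z' := Submodule.reflection_sub h
  have hmp : MeasurePreserving R volume volume := R.measurePreserving
  let e : Space ≃ᵐ Space := R.toHomeomorph.toMeasurableEquiv
  have he : (e : Space → Space) = R := rfl
  have hpre : R ⁻¹' ball z' η = ball z η := by
    rw [← hRz, ← R.image_ball, Set.preimage_image_eq _ R.injective]
  unfold ballIntegral
  rw [← lintegral_indicator measurableSet_ball, ← lintegral_indicator measurableSet_ball]
  symm
  calc ∫⁻ w, (ball z' η).indicator (fun w => v ‖w‖) w
      = ∫⁻ w, (ball z' η).indicator (fun w => v ‖w‖) w ∂(Measure.map e volume) := by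
        rw [he, hmp.map_eq]
    _ = ∫⁻ u, (ball z' η).indicator (fun w => v ‖w‖) (e u) := lintegral_map_equiv _ e
    _ = ∫⁻ u, (ball z η).indicator (fun w => v ‖w‖) u := by
        refine lintegral_congr fun u => ?_
        change (ball z' η).indicator (fun w => v ‖w‖) (R u) = _
        by_cases hu : u ∈ ball z η
        · have hu' : R u ∈ ball z' η := by rw [← hpre] at hu; exact hu
          rw [indicator_of_mem hu, indicator_of_mem hu', R.norm_map]
        · have hu' : R u ∉ ball z' η := by rw [← hpre] at hu; exact hu
          rw [indicator_of_notMem hu, indicator_of_notMem hu']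

/-- Membership in the hard set depends only on `|z|`. [folklore] -/
theorem mem_hardVec_iff_of_norm_eq {z z' : Space} (h : ‖z‖ = ‖z'‖) :
    z ∈ hardVec v ↔ z' ∈ hardVec v := by
  simp only [hardVec, mem_setOf_eq, ballIntegral_eq_of_norm_eq h]

/-- `-z ∈ 𝓗(v) ↔ z ∈ 𝓗(v)`. [folklore] -/
theorem neg_mem_hardVec_iff {z : Space} : -z ∈ hardVec v ↔ z ∈ hardVec v :=
  mem_hardVec_iff_of_norm_eq (norm_neg z)

/-- For a potential of range `R₀` the hard set lies in the closed ball of radius `R₀`: around a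
relative position beyond the range the potential vanishes. [cite: LSSY2005, Ch. 2 (2.1)] -/
theorem not_mem_hardVec_of_lt_norm {R₀ : ℝ} (hv0 : ∀ r, R₀ < r → v r = 0) {z : Space}
    (hz : R₀ < ‖z‖) : z ∉ hardVec v := by
  refine not_mem_hardVec_iff.2 ⟨‖z‖ - R₀, by linarith, ?_⟩
  have h0 : ∀ w ∈ ball z (‖z‖ - R₀), v ‖w‖ = 0 := by
    intro w hw
    apply hv0
    rw [mem_ball, dist_eq_norm] at hw
    have h2 : ‖z‖ - ‖w‖ ≤ ‖w - z‖ := by rw [norm_sub_rev]; exact norm_sub_norm_le z w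
    linarith
  unfold ballIntegral
  rw [setLIntegral_congr_fun measurableSet_ball h0]
  simp

/-- The hard set of a potential of range `R₀ ≥ 0` is compact. [folklore] -/
theorem isCompact_hardVec {R₀ : ℝ} (hv0 : ∀ r, R₀ < r → v r = 0) : IsCompact (hardVec v) := by
  refine (isCompact_closedBall (0 : Space) R₀).of_isClosed_subset isClosed_hardVec fun z hz => ?_
  rw [mem_closedBall, dist_zero_right]
  by_contra h
  exact not_mem_hardVec_of_lt_norm hv0 (not_le.1 h) hz

end HardSet

/-! ### Finite energy keeps the particles off the hard set -/

section Feasible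

variable {N : ℕ} {v : ℝ → ℝ≥0∞}

/-- A single pair term is at most the interaction. [folklore] -/
theorem apply_dist_le_interaction (v : ℝ → ℝ≥0∞) (X : Config N) {i j : Fin N} (hij : i ≠ j) :
    v (dist (X i) (X j)) ≤ interaction v X := by
  classical
  unfold interaction
  rcases lt_or_gt_of_ne hij with h | h
  · refine le_trans ?_ (Finset.single_le_sum (f := fun i => ∑ j ∈ Finset.univ.filter (fun j => i < j),
      v (dist (X i) (X j))) (fun _ _ => zero_le) (Finset.mem_univ i))
    exact Finset.single_le_sum (f := fun j => v (dist (X i) (X j))) (fun _ _ => zero_le)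
      (Finset.mem_filter.2 ⟨Finset.mem_univ j, h⟩)
  · refine le_trans ?_ (Finset.single_le_sum (f := fun i => ∑ j ∈ Finset.univ.filter (fun j => i < j),
      v (dist (X i) (X j))) (fun _ _ => zero_le) (Finset.mem_univ j))
    rw [dist_comm]
    exact Finset.single_le_sum (f := fun j' => v (dist (X j) (X j'))) (fun _ _ => zero_le)
      (Finset.mem_filter.2 ⟨Finset.mem_univ i, h⟩)

/-- Translating the ball: `∫_{B(c,η)} v(|x - p|) dx = ∫_{B(c - p, η)} v(|w|) dw`. [folklore] -/
theorem setLIntegral_ball_comp_sub (v : ℝ → ℝ≥0∞) (c p : Space) (η : ℝ) :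
    ∫⁻ x in ball c η, v ‖x - p‖ = ballIntegral v (c - p) η := by
  unfold ballIntegral
  rw [← lintegral_indicator measurableSet_ball, ← lintegral_indicator measurableSet_ball]
  have h : ∀ x : Space, (ball c η).indicator (fun x => v ‖x - p‖) x =
      (ball (c - p) η).indicator (fun w => v ‖w‖) (x - p) := by
    intro x
    have hmem : x ∈ ball c η ↔ x - p ∈ ball (c - p) η := by
      rw [mem_ball, mem_ball, dist_eq_norm, dist_eq_norm, sub_sub_sub_cancel_right]
    by_cases hx : x ∈ ball c η
    · rw [indicator_of_mem hx, indicator_of_mem (hmem.1 hx)]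
    · rw [indicator_of_notMem hx, indicator_of_notMem (fun h' => hx (hmem.2 h'))]
  simp_rw [h]
  exact lintegral_sub_right_eq_self (fun w => (ball (c - p) η).indicator (fun w => v ‖w‖) w) p

/-- **Finite energy keeps the particles off the hard set.** If the continuous wave function `ψ`
has finite energy and does not vanish at `X`, then no relative position `xᵢ - xⱼ` (`i ≠ j`) lies
in the hard set of `v`: otherwise `|ψ|² ≥ c > 0` on a ball around `X`, and the integral of
`v(|xᵢ - xⱼ|)` in the single coordinate `xᵢ` over that ball is already `+∞`.
[cite: LSSY2005, Ch. 2, paragraph after eq. (2.1)] -/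
theorem not_mem_hardVec_of_apply_ne_zero (hv : Measurable v) {ψ : Config N → ℂ}
    (hψ : Continuous ψ) (hE : rawEnergy v ψ ≠ ⊤) {X : Config N} (hX : ψ X ≠ 0) {i j : Fin N}
    (hij : i ≠ j) : X i - X j ∉ hardVec v := by
  classical
  intro hmem
  apply hE
  -- a ball on which `|ψ|² ≥ c > 0`
  have hpos : 0 < ‖ψ X‖ := norm_pos_iff.2 hX
  obtain ⟨ε, hε, hball⟩ : ∃ ε > 0, ∀ Y, dist Y X < ε → ‖ψ X‖ / 2 < ‖ψ Y‖ := by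
    have h := (hψ.norm.continuousAt (x := X)).eventually (lt_mem_nhds (half_lt_self hpos))
    obtain ⟨ε, hε, h⟩ := Metric.eventually_nhds_iff.1 h
    exact ⟨ε, hε, fun Y hY => h hY⟩
  set c : ℝ≥0∞ := ENNReal.ofReal ((‖ψ X‖ / 2) ^ 2) with hc
  have hc0 : c ≠ 0 := by
    rw [hc]; exact (ENNReal.ofReal_pos.2 (by positivity)).ne'
  have hsq : ∀ Y, dist Y X < ε → c ≤ (‖ψ Y‖₊ : ℝ≥0∞) ^ 2 := by
    intro Y hY
    rw [hc, show ((‖ψ Y‖₊ : ℝ≥0∞)) ^ 2 = ENNReal.ofReal (‖ψ Y‖ ^ 2) by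
      rw [ENNReal.ofReal_pow (norm_nonneg _), ofReal_norm]; rfl]
    exact ENNReal.ofReal_le_ofReal (pow_le_pow_left₀ (by positivity) (hball Y hY).le 2)
  -- the pair integrand restricted to the ball dominates `c · 1_ball · v`
  set F : Config N → ℝ≥0∞ := fun Y => (ball X ε).indicator (fun Y => v (dist (Y i) (Y j))) Y
    with hF
  have hFY : ∀ Y, F Y = (ball X ε).indicator (fun Y => v (dist (Y i) (Y j))) Y := fun Y => rfl
  have hFm : Measurable F :=
    (hv.comp (measurable_dist_pair i j)).indicator measurableSet_ball
  have hdom : ∀ Y, c * F Y ≤ kineticDensity ψ Y + interaction v Y * (‖ψ Y‖₊ : ℝ≥0∞) ^ 2 := by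
    intro Y
    by_cases hY : Y ∈ ball X ε
    · rw [hFY, indicator_of_mem hY, mul_comm]
      exact le_add_left (mul_le_mul' (apply_dist_le_interaction v Y hij) (hsq Y hY))
    · rw [hFY, indicator_of_notMem hY, mul_zero]; exact zero_le
  -- a smaller product ball `S`, and the comparison function `G = ⊤ · 1_S`
  set S : Set (Config N) := ball X (ε / 2) with hS
  set G : Config N → ℝ≥0∞ := S.indicator (fun _ => ⊤) with hG
  have hGm : Measurable G := measurable_const.indicator measurableSet_ball
  have hGF : ∫⁻ Y, G Y ≤ ∫⁻ Y, F Y := by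
    have hvol : (volume : Measure (Config N)) = Measure.pi fun _ => volume := rfl
    rw [hvol]
    refine lintegral_le_of_lmarginal_le {i} hGm hFm ?_
    rw [lmarginal_singleton, lmarginal_singleton]
    intro Y
    change (∫⁻ x : Space, G (update Y i x)) ≤ ∫⁻ x : Space, F (update Y i x)
    by_cases hrest : ∀ k, k ≠ i → dist (Y k) (X k) < ε / 2
    · -- the fibre of `F` through `Y` contains a hard ball: its integral is `⊤`
      refine le_trans le_top (le_of_eq ?_)
      symm
      rw [eq_top_iff]
      have hsub : ∀ x : Space, (ball (X i) (ε / 2)).indicator (fun x => v ‖x - Y j‖) x ≤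
          F (update Y i x) := by
        intro x
        by_cases hx : x ∈ ball (X i) (ε / 2)
        · rw [indicator_of_mem hx, hFY, indicator_of_mem, update_self,
            update_of_ne hij.symm, dist_eq_norm]
          rw [mem_ball, dist_pi_lt_iff hε]
          intro k
          rcases eq_or_ne k i with rfl | hk
          · rw [update_self]; exact lt_of_lt_of_le (mem_ball.1 hx) (by linarith)
          · rw [update_of_ne hk]; exact (hrest k hk).trans_le (by linarith)
        · rw [indicator_of_notMem hx]; exact zero_le
      calc (⊤ : ℝ≥0∞) = ballIntegral v (X i - X j) (ε / 2 - dist (Y j) (X j)) :=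
            (hmem _ (by linarith [hrest j hij.symm])).symm
        _ ≤ ballIntegral v (X i - Y j) (ε / 2) := by
            refine ballIntegral_mono (ball_subset_ball' ?_)
            have hd : dist (X i - X j) (X i - Y j) = dist (Y j) (X j) := by
              rw [dist_eq_norm, dist_eq_norm, sub_sub_sub_cancel_left]
            rw [hd]
            linarith
        _ = ∫⁻ x in ball (X i) (ε / 2), v ‖x - Y j‖ := (setLIntegral_ball_comp_sub v _ _ _).symm
        _ = ∫⁻ x, (ball (X i) (ε / 2)).indicator (fun x => v ‖x - Y j‖) x :=
            (lintegral_indicator measurableSet_ball _).symm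
        _ ≤ ∫⁻ x, F (update Y i x) := lintegral_mono hsub
    · -- otherwise the fibre of `G` vanishes
      have h0 : ∀ x : Space, G (update Y i x) = 0 := by
        intro x
        rw [hG, indicator_of_notMem]
        intro hmemS
        apply hrest
        intro k hk
        have := (dist_pi_lt_iff (by positivity : (0:ℝ) < ε / 2)).1 (mem_ball.1 hmemS) k
        rwa [update_of_ne hk] at this
      simp [h0]
  have hGtop : ∫⁻ Y, G Y = ⊤ := by
    rw [hG, lintegral_indicator measurableSet_ball, setLIntegral_const]
    refine ENNReal.top_mul ?_
    exact (measure_ball_pos volume X (by positivity)).ne'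
  have hFtop : ∫⁻ Y, F Y = ⊤ := eq_top_iff.2 (hGtop ▸ hGF)
  rw [eq_top_iff]
  calc (⊤ : ℝ≥0∞) = c * ∫⁻ Y, F Y := by rw [hFtop, ENNReal.mul_top hc0]
    _ = ∫⁻ Y, c * F Y := (lintegral_const_mul _ hFm).symm
    _ ≤ rawEnergy v ψ := lintegral_mono hdom

/-- Equivalently: a continuous wave function of finite energy vanishes at every configuration with
a relative position in the hard set. [cite: LSSY2005, Ch. 2, paragraph after eq. (2.1)] -/
theorem eq_zero_of_sub_mem_hardVec (hv : Measurable v) {ψ : Config N → ℂ} (hψ : Continuous ψ)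
    (hE : rawEnergy v ψ ≠ ⊤) {X : Config N} {i j : Fin N} (hij : i ≠ j)
    (h : X i - X j ∈ hardVec v) : ψ X = 0 := by
  by_contra hX
  exact not_mem_hardVec_of_apply_ne_zero hv hψ hE hX hij h

end Feasible

/-! ### The radial description of the hard set -/

section Radial

variable {v : ℝ → ℝ≥0∞}

/-- A fixed unit vector of `ℝ³`. [folklore] -/
def unitE : Space := EuclideanSpace.single 0 1

/-- `|e₀| = 1`. [folklore] -/
@[simp]
theorem norm_unitE : ‖unitE‖ = 1 := by
  simp [unitE]

/-- `|r e₀| = r` for `r ≥ 0`. [folklore] -/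
theorem norm_smul_unitE {r : ℝ} (hr : 0 ≤ r) : ‖r • unitE‖ = r := by
  rw [norm_smul, norm_unitE, mul_one, Real.norm_eq_abs, abs_of_nonneg hr]

/-- The **hard radii** of the potential: `r ≥ 0` with `r e₀ ∈ 𝓗(v)` (equivalently, by rotation
invariance, with the whole sphere of radius `r` in `𝓗(v)`). [folklore] -/
def hardRad (v : ℝ → ℝ≥0∞) : Set ℝ :=
  {r | 0 ≤ r ∧ r • unitE ∈ hardVec v}

/-- `z ∈ 𝓗(v) ↔ |z|` is a hard radius. [folklore] -/
theorem mem_hardVec_iff_norm_mem_hardRad {z : Space} : z ∈ hardVec v ↔ ‖z‖ ∈ hardRad v := by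
  simp only [hardRad, mem_setOf_eq, norm_nonneg, true_and]
  exact mem_hardVec_iff_of_norm_eq (norm_smul_unitE (norm_nonneg z)).symm

/-- Hard radii are nonnegative. [folklore] -/
theorem nonneg_of_mem_hardRad {r : ℝ} (h : r ∈ hardRad v) : 0 ≤ r := h.1

/-- The hard radii form a closed set. [folklore] -/
theorem isClosed_hardRad : IsClosed (hardRad v) :=
  (isClosed_le continuous_const continuous_id).inter
    (isClosed_hardVec.preimage (continuous_id.smul continuous_const))

/-- Hard radii of a potential of range `R₀` are at most `R₀`. [cite: LSSY2005, Ch. 2 (2.1)] -/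
theorem le_of_mem_hardRad {R₀ : ℝ} (hv0 : ∀ r, R₀ < r → v r = 0) {r : ℝ} (h : r ∈ hardRad v) :
    r ≤ R₀ := by
  by_contra hlt
  refine not_mem_hardVec_of_lt_norm hv0 ?_ h.2
  rwa [norm_smul_unitE h.1, ← not_le]

/-- **The wave function vanishes on every hard sphere**: if `|xᵢ - xⱼ|` is a hard radius then a
continuous finite-energy wave function vanishes at `X`. [cite: LSSY2005, Ch. 2, paragraph after eq. (2.1)] -/
theorem eq_zero_of_dist_mem_hardRad (hv : Measurable v) {N : ℕ} {ψ : Config N → ℂ}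
    (hψ : Continuous ψ) (hE : rawEnergy v ψ ≠ ⊤) {X : Config N} {i j : Fin N} (hij : i ≠ j)
    (h : dist (X i) (X j) ∈ hardRad v) : ψ X = 0 :=
  eq_zero_of_sub_mem_hardVec hv hψ hE hij
    (mem_hardVec_iff_norm_mem_hardRad.2 (by rwa [← dist_eq_norm]))

end Radial

/-! ### Integrability of the potential away from the hard set -/

section Integrable

variable {v : ℝ → ℝ≥0∞}

/-- Finite subadditivity of the integral over a finite union. [folklore] -/
private theorem setLIntegral_biUnion_finset_le {α ι : Type*} [MeasurableSpace α] (μ : Measure α)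
    (s : Finset ι) (t : ι → Set α) (f : α → ℝ≥0∞) :
    ∫⁻ a in ⋃ i ∈ s, t i, f a ∂μ ≤ ∑ i ∈ s, ∫⁻ a in t i, f a ∂μ := by
  classical
  induction s using Finset.induction_on with
  | empty => simp
  | insert a s ha ih =>
    rw [Finset.set_biUnion_insert, Finset.sum_insert ha]
    exact (lintegral_union_le _ _ _).trans (by gcongr)

/-- **Away from the hard set the potential is locally integrable, uniformly on compacts**: for a
compact set `K` of relative positions disjoint from `𝓗(v)`, `∫_K v(|w|) dw < ∞` (cover `K` by
finitely many balls of finite integral). [folklore] -/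
theorem setLIntegral_lt_top_of_isCompact_subset_compl_hardVec {K : Set Space} (hK : IsCompact K)
    (hKH : K ⊆ (hardVec v)ᶜ) : ∫⁻ w in K, v ‖w‖ < ⊤ := by
  classical
  -- radii of finite balls
  have hrad : ∀ z ∈ K, ∃ η : ℝ, 0 < η ∧ ballIntegral v z η < ⊤ := fun z hz =>
    not_mem_hardVec_iff.1 (hKH hz)
  choose! η hη hfin using hrad
  obtain ⟨t, htK, hcover⟩ := hK.elim_nhds_subcover (fun z => ball z (η z))
    (fun z hz => ball_mem_nhds z (hη z hz))
  calc ∫⁻ w in K, v ‖w‖ ≤ ∫⁻ w in ⋃ z ∈ t, ball z (η z), v ‖w‖ := lintegral_mono_set hcover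
    _ ≤ ∑ z ∈ t, ∫⁻ w in ball z (η z), v ‖w‖ :=
        setLIntegral_biUnion_finset_le volume t (fun z => ball z (η z)) _
    _ < ⊤ := ENNReal.sum_lt_top.2 fun z hz => hfin z (htK z hz)

/-- The relative positions of norm at most `R` whose norm keeps distance `≥ θ` from the hard
radii form a compact set disjoint from the hard set. [folklore] -/
def looseShell (v : ℝ → ℝ≥0∞) (R θ : ℝ) : Set Space :=
  {z | ‖z‖ ≤ R ∧ ∀ h ∈ hardRad v, θ ≤ |‖z‖ - h|}

/-- The loose shell is closed. [folklore] -/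
theorem isClosed_looseShell (R θ : ℝ) : IsClosed (looseShell v R θ) := by
  have h1 : IsClosed {z : Space | ‖z‖ ≤ R} := isClosed_le continuous_norm continuous_const
  have h2 : looseShell v R θ = {z : Space | ‖z‖ ≤ R} ∩ ⋂ h ∈ hardRad v, {z | θ ≤ |‖z‖ - h|} := by
    ext z; simp [looseShell]
  rw [h2]
  exact h1.inter (isClosed_biInter fun h _ =>
    isClosed_le continuous_const ((continuous_norm.sub continuous_const).abs))

/-- The loose shell is compact. [folklore] -/
theorem isCompact_looseShell (R θ : ℝ) : IsCompact (looseShell v R θ) :=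
  (isCompact_closedBall (0 : Space) R).of_isClosed_subset (isClosed_looseShell R θ)
    fun z hz => by rw [mem_closedBall, dist_zero_right]; exact hz.1

/-- The loose shell avoids the hard set (`θ > 0`). [folklore] -/
theorem looseShell_subset_compl_hardVec {R θ : ℝ} (hθ : 0 < θ) :
    looseShell v R θ ⊆ (hardVec v)ᶜ := by
  intro z hz hzH
  have h := hz.2 ‖z‖ (mem_hardVec_iff_norm_mem_hardRad.1 hzH)
  rw [sub_self, abs_zero] at h
  exact absurd h (not_le.2 hθ)

/-- **The loose-shell integral is finite**: `I(R, θ) := ∫_{|w| ≤ R, dist(|w|, hard radii) ≥ θ} v(|w|) dw < ∞`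
for `θ > 0`. [folklore] -/
theorem setLIntegral_looseShell_lt_top (R : ℝ) {θ : ℝ} (hθ : 0 < θ) :
    ∫⁻ w in looseShell v R θ, v ‖w‖ < ⊤ :=
  setLIntegral_lt_top_of_isCompact_subset_compl_hardVec (isCompact_looseShell R θ)
    (looseShell_subset_compl_hardVec hθ)

/-- A ball whose centre has norm `≤ R - η` and keeps distance `≥ θ + η` from the hard radii lies
in the loose shell `looseShell v R θ`. [folklore] -/
theorem ball_subset_looseShell {R θ η : ℝ} {z : Space} (hzR : ‖z‖ + η ≤ R)
    (hz : ∀ h ∈ hardRad v, θ + η ≤ |‖z‖ - h|) : ball z η ⊆ looseShell v R θ := by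
  intro w hw
  rw [mem_ball, dist_eq_norm] at hw
  have hn : |‖w‖ - ‖z‖| ≤ ‖w - z‖ := abs_norm_sub_norm_le w z
  refine ⟨?_, fun h hh => ?_⟩
  · have := (abs_le.1 hn).2; linarith
  · have h1 := hz h hh
    have h2 : |‖z‖ - h| ≤ |‖w‖ - h| + |‖w‖ - ‖z‖| := by
      calc |‖z‖ - h| = |(‖w‖ - h) - (‖w‖ - ‖z‖)| := by ring_nf
        _ ≤ |‖w‖ - h| + |‖w‖ - ‖z‖| := abs_sub _ _
    linarith

/-- Hence the ball integral around such a centre is bounded by the loose-shell integral.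
[folklore] -/
theorem ballIntegral_le_setLIntegral_looseShell {R θ η : ℝ} {z : Space} (hzR : ‖z‖ + η ≤ R)
    (hz : ∀ h ∈ hardRad v, θ + η ≤ |‖z‖ - h|) :
    ballIntegral v z η ≤ ∫⁻ w in looseShell v R θ, v ‖w‖ :=
  lintegral_mono_set (ball_subset_looseShell hzR hz)

end Integrable

end Literature.MathematicalPhysics.QuantumManyBody.BoseGas

end
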